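import Literature.Barriers.AtomisticToContinuum.StrongPinningBreathersUniqueness
import Literature.MathematicalPhysics.KineticTheory.ConfinedLocalMinorization
import Literature.MathematicalPhysics.KineticTheory.LangevinChainConfinedKalman
import HarnessLib

/-!
# Hairer–Mattingly (2009): the local small set at the equilibrium, and the theorem from Theorem 5.6 alone

Trunk T-KINETIC (Literature/Barriers/AtomisticToContinuum). Provefact unit for the named fact
`HairerMattingly2009_threeOscillators` (`StrongPinningBreathers.lean`). This file supplies the
last model-specific input of the UNIQUENESS half of the three-oscillator theorem of [HM09, §1 with
Prop. 5.1 and Thm 5.6] ("the uniqueness of an invariant measure … follows quickly from the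
hypoellipticity of the generator and the Hamiltonian structure once the existence of an invariant
measure is established" [HM09, §1]): the LOCAL MINORISATION of the
transition probabilities of the Hairer–Mattingly chain (pinning `|q|^{2k}/2k`, `k > 3/2`, harmonic
coupling, heat baths at both ends) near its equilibrium `0`, obtained Hörmander-free from the
model-free `ConfinedDrift.exists_localSmall_window` (`ConfinedLocalMinorization.lean`):

* the drift `Y = (p, -∇Φ(q) - γ 1_B p)` is `C¹` (the potentials are `C²`,
  `homogeneouslyPinnedChain_contDiff_two_U`) and vanishes at `0` (`U'(0) = V'(0) = 0`);
* KALMAN's condition for `(DY(0), v_L)`, `v_L = √(2γT_L) ∂_{p_0}`, is the peeling argument of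
  `OscillatorChain.eq_zero_of_forall_pow_unitP_zero₂` (`LangevinChainConfinedKalman.lean`), which
  uses only `V''(0) = 1 ≠ 0` (here `U''(0) = 0`, the linearisation at `0` is the free-end harmonic
  chain);

whence `homogeneouslyPinnedChain_localSmall` — hypothesis `hloc` of
`HairerMattingly2009_threeOscillators_of_thm56_of_lebesgueLocalSmall`
(`StrongPinningBreathersUniqueness.lean`) —, `homogeneouslyPinnedChain_invariant_unique` (AT MOST
ONE invariant probability measure for the chain of ANY length `N ≥ 1`, the uniqueness claim of
[HM09, §1], proved) and

* `HairerMattingly2009_threeOscillators_of_thm56` — **the named fact follows from the printed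
  statement of [HM09, Theorem 5.6] (the Lyapunov function of the three-oscillator chain) ALONE**:
  the semigroup (`StrongPinningBreathersSemigroup.lean`), existence given Thm 5.6
  (`StrongPinningBreathersExistence.lean`, [HM09, Prop. 5.1] proved) and uniqueness
  (`StrongPinningBreathersUniqueness.lean` + this file) are all proved.

## References

* M. Hairer, J. C. Mattingly, *Slow energy dissipation in anharmonic oscillator chains*,
  Comm. Pure Appl. Math. **62** (2009) 999–1032 (arXiv:0712.3884), §1 (uniqueness from
  hypoellipticity and the Hamiltonian structure), Prop. 5.1, Thm 5.6.
  [cite: HairerMattingly2009, §1 and Prop 5.1 and Thm 5.6]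
* N. Cuneo, J.-P. Eckmann, M. Hairer, L. Rey-Bellet, EJP **23** (2018) no. 55, Prop. 3.6.
-/

noncomputable section

open MeasureTheory ProbabilityTheory Filter Topology Set Metric
open scoped NNReal ENNReal

namespace Literature.Barriers.AtomisticToContinuum.HeatConduction

open Literature.MathematicalPhysics.KineticTheory Literature.MathematicalPhysics.KineticTheory.HeatConduction
open Literature.Probability.Process

variable {k γ : ℝ} {N : ℕ} {T_L T_R : ℝ}

/-- `U'(0) = 0` for the homogeneous pinning (`2k > 1`). [cite: HairerMattingly2009, §2] -/
theorem homogeneouslyPinnedChain_deriv_U_zero (hk : 1 < 2 * k) (γ : ℝ) :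
    deriv (homogeneouslyPinnedChain k γ).U 0 = 0 := by
  rw [homogeneouslyPinnedChain_deriv_U hk γ]
  simp

/-- `V'' ≡ 1` for the harmonic coupling, in particular `V''(0) ≠ 0`. [cite: HairerMattingly2009, §2] -/
theorem homogeneouslyPinnedChain_deriv_deriv_V (k γ r : ℝ) :
    deriv (deriv (homogeneouslyPinnedChain k γ).V) r = 1 := by
  have h : deriv (homogeneouslyPinnedChain k γ).V = fun r => r :=
    funext (homogeneouslyPinnedChain_deriv_V k γ)
  rw [h, deriv_id'']

/-- **The equilibrium**: the drift of the Hairer–Mattingly chain vanishes at `0`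
(`U'(0) = V'(0) = 0`). [cite: HairerMattingly2009, §2] -/
theorem homogeneouslyPinnedChain_drift_zero (hk : 3 / 2 < k) (hγ : 0 ≤ γ) (N : ℕ) :
    (homogeneouslyPinnedChain k γ).drift N 0 = 0 := by
  have hk1 : 1 < 2 * k := by linarith
  have hU0 := homogeneouslyPinnedChain_deriv_U_zero hk1 γ
  have hV0 : deriv (homogeneouslyPinnedChain k γ).V 0 = 0 := homogeneouslyPinnedChain_deriv_V k γ 0
  rw [(homogeneouslyPinnedChain_isConfining hk hγ).drift_apply N 0]
  refine Prod.ext rfl (funext fun i => ?_)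
  simp [OscillatorChain.dPotential, hU0, hV0]

/-- **Kalman's condition at the equilibrium for the left bath direction**: a linear functional
annihilating all `DY(0)ʲ v_L`, `v_L = √(2γT_L) ∂_{p_0}` (`γ, T_L > 0`), vanishes.
[cite: HairerMattingly2009, §1] -/
theorem homogeneouslyPinnedChain_kalman_bathVecL (hk : 3 / 2 < k) (hγ : 0 < γ) (hN : 0 < N)
    (hTL : 0 < T_L) (ℓ : PhaseSpace N →ₗ[ℝ] ℝ)
    (h : ∀ j : ℕ, ℓ (((fderiv ℝ ((homogeneouslyPinnedChain k γ).drift N) 0) ^ j)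
      ((homogeneouslyPinnedChain k γ).bathVecL N T_L)) = 0) :
    ℓ = 0 := by
  set P := homogeneouslyPinnedChain k γ with hP
  have hcL : Real.sqrt (2 * γ * T_L) ≠ 0 := (Real.sqrt_pos.2 (by positivity)).ne'
  have hbL : P.bathVecL N T_L = Real.sqrt (2 * γ * T_L) • unitP ⟨0, hN⟩ := by
    show bathVec N 0 (Real.sqrt (2 * γ * T_L)) = _
    rw [bathVec_eq_smul_unitP hN]
  have hV0 : deriv (deriv P.V) 0 ≠ 0 := by
    rw [hP, homogeneouslyPinnedChain_deriv_deriv_V k γ 0]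
    exact one_ne_zero
  refine P.eq_zero_of_forall_pow_unitP_zero₂ (homogeneouslyPinnedChain_contDiff_two_U hk γ)
    (homogeneouslyPinnedChain_contDiff_V k γ) hV0 hN ℓ fun j => ?_
  have hj := h j
  rw [hbL, ContinuousLinearMap.map_smul, LinearMap.map_smul, smul_eq_mul] at hj
  exact (mul_eq_zero.1 hj).resolve_left hcL

/-- **The local small set of the Hairer–Mattingly chain at the equilibrium, in a time window**
(Hörmander-free; `k > 3/2`, `γ > 0`, `N ≥ 1`, `T_L > 0`): there are an open neighbourhood `G₀`
of `0`, a non-empty open `U₀`, `η > 0` and a window `[t₀ - δ, t₀ + δ]` (`0 < δ ≤ t₀`) with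
`P_t(w, ·) ≥ η Leb|_{U₀}` for all `w ∈ G₀` and `t` in the window — hypothesis `hloc` of
`HairerMattingly2009_threeOscillators_of_thm56_of_lebesgueLocalSmall`.
[cite: HairerMattingly2009, §1] [cite: CuneoEckmannHairerReyBellet2018, Prop 3.6 (proof)] -/
theorem homogeneouslyPinnedChain_localSmall (hk : 3 / 2 < k) (hγ : 0 < γ) (hN : 0 < N)
    (hTL : 0 < T_L) (T_R : ℝ) :
    ∃ (G₀ U₀ : Set (PhaseSpace N)) (η : ℝ≥0∞) (t₀ δ : ℝ), IsOpen G₀ ∧ (0 : PhaseSpace N) ∈ G₀ ∧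
      IsOpen U₀ ∧ U₀.Nonempty ∧ 0 < η ∧ 0 < δ ∧ δ ≤ t₀ ∧
      ∀ t : ℝ≥0, t₀ - δ ≤ (t : ℝ) → (t : ℝ) ≤ t₀ + δ → ∀ w ∈ G₀,
        η • (volume : Measure (PhaseSpace N)).restrict U₀ ≤
          (homogeneouslyPinnedChain k γ).langevinKernel N T_L T_R t w := by
  set P := homogeneouslyPinnedChain k γ with hP
  have hPc : P.IsConfining := homogeneouslyPinnedChain_isConfining hk hγ.le
  let D : ConfinedDrift (P.drift N) := (hPc.confinedDrift N).toConfinedDrift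
  have hY : ContDiff ℝ 1 (P.drift N) :=
    P.contDiff_one_drift (homogeneouslyPinnedChain_contDiff_two_U hk γ)
      (homogeneouslyPinnedChain_contDiff_V k γ) N
  have hx₀ : P.drift N 0 = 0 := homogeneouslyPinnedChain_drift_zero hk hγ.le N
  have hv₁ : P.bathVecL N T_L ∈ D.noise := hPc.bathVec_mem_noise N 0 _
  have hv₂ : P.bathVecR N T_R ∈ D.noise := hPc.bathVec_mem_noise N (N - 1) _
  have hKal : ∀ ℓ : PhaseSpace N →ₗ[ℝ] ℝ,
      (∀ j : ℕ, ℓ (((fderiv ℝ (P.drift N) 0) ^ j) (P.bathVecL N T_L)) = 0) → ℓ = 0 :=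
    fun ℓ h => homogeneouslyPinnedChain_kalman_bathVecL hk hγ hN hTL ℓ h
  haveI hpi : (volume : Measure (Fin N → ℝ)).IsAddHaarMeasure := isAddHaarMeasure_volume_pi _
  haveI : (volume : Measure (PhaseSpace N)).IsAddHaarMeasure :=
    Measure.prod.instIsAddHaarMeasure (volume : Measure (Fin N → ℝ)) (volume : Measure (Fin N → ℝ))
  obtain ⟨G₀, U₀, η, t₀, δ, hG₀, h0, hU₀, hU₀ne, hη, hδ, hδt, hmin⟩ :=
    D.exists_localSmall_window hY hx₀ hv₁ hv₂ hKal (volume : Measure (PhaseSpace N))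
  exact ⟨G₀, U₀, η, t₀, δ, hG₀, h0, hU₀, hU₀ne, hη, hδ, hδt, hmin⟩

/-- **Uniqueness of the invariant probability measure of the Hairer–Mattingly chain of ANY
length** (`k > 3/2`, `γ > 0`, `N ≥ 1` sites, `T_L > 0`, `T_R ≥ 0`): the transition semigroup
`homogeneouslyPinnedChainSemigroup` has at most one invariant probability measure — "the
uniqueness of an invariant measure for a chain of arbitrary length follows quickly from the
hypoellipticity of the generator and the Hamiltonian structure" [HM09, §1]; here PROVED
Hörmander-free (local minorisation at the equilibrium + LaSalle irreducibility + Doeblin).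
[cite: HairerMattingly2009, §1] -/
theorem homogeneouslyPinnedChain_invariant_unique (hk : 3 / 2 < k) (hγ : 0 < γ) (hN : 0 < N)
    (hTL : 0 < T_L) (hTR : 0 ≤ T_R) {μ ν : Measure (PhaseSpace N)} [IsProbabilityMeasure μ]
    [IsProbabilityMeasure ν]
    (hμ : (homogeneouslyPinnedChainSemigroup hk hγ.le hN hTL.le hTR).IsInvariant μ)
    (hν : (homogeneouslyPinnedChainSemigroup hk hγ.le hN hTL.le hTR).IsInvariant ν) : μ = ν := by
  obtain ⟨G₀, U₀, η, t₀, δ, hG₀, h0, hU₀, ⟨y₀, hy₀⟩, hη, hδ, hδt, hmin⟩ :=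
    homogeneouslyPinnedChain_localSmall hk hγ hN hTL T_R
  refine homogeneouslyPinnedChain_invariant_unique_of_localSmall hk hγ hN hTL.le hTR hG₀ h0
    (ν₀ := η • (volume : Measure (PhaseSpace N)).restrict U₀) (y₀ := y₀) (fun V hV hyV => ?_)
    hδ hδt hmin hμ hν
  rw [Measure.smul_apply, Measure.restrict_apply hV.measurableSet, smul_eq_mul]
  exact ENNReal.mul_pos hη.ne' ((hV.inter hU₀).measure_pos volume ⟨y₀, hyV, hy₀⟩).ne'

end Literature.Barriers.AtomisticToContinuum.HeatConduction

namespace Literature.Barriers.AtomisticToContinuum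

open Literature.MathematicalPhysics.KineticTheory.HeatConduction
open Literature.Barriers.AtomisticToContinuum.HeatConduction

/-- **The three-oscillator theorem of [HM09] from the printed statement of [HM09, Theorem 5.6]
alone.** If, for every `k > 3/2`, `γ > 0`, `T_L, T_R > 0`, the chain of three oscillators admits
a `C²` function `𝒱` with `𝒱 ≥ c H^α - C` and `L𝒱 ≤ C - c H^{α'}` (`c, C, α, α' > 0`) — the
content of [HM09, Thm 5.6], where `α = 3/2 - 1/(2k) - ε`, `α' = 1/2 - 3/(2k) - ε'` — then the
Langevin dynamics of the three-oscillator Hairer–Mattingly chain has a transition semigroup with a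
unique invariant probability measure. Everything else — the semigroup, [HM09, Prop. 5.1]
(Lyapunov drift ⟹ existence), the Hörmander-free local minorisation at the equilibrium,
LaSalle-type irreducibility and the Doeblin–Khasminskii uniqueness argument — is proved in this
tree. [cite: HairerMattingly2009, §1 and Prop 5.1 and Thm 5.6] -/
theorem HairerMattingly2009_threeOscillators_of_thm56
    (h56 : ∀ k γ : ℝ, 3 / 2 < k → 0 < γ → ∀ T_L T_R : ℝ, 0 < T_L → 0 < T_R →
      ∃ (𝒱 : PhaseSpace 3 → ℝ) (c C α α' : ℝ), ContDiff ℝ 2 𝒱 ∧ 0 < c ∧ 0 < C ∧ 0 < α ∧ 0 < α' ∧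
        (∀ x, c * (homogeneouslyPinnedChain k γ).hamiltonian 3 x ^ α - C ≤ 𝒱 x) ∧
        (∀ x, (homogeneouslyPinnedChain k γ).generator 3 T_L T_R 𝒱 x ≤
          C - c * (homogeneouslyPinnedChain k γ).hamiltonian 3 x ^ α')) :
    HairerMattingly2009_threeOscillators :=
  HairerMattingly2009_threeOscillators_of_thm56_of_lebesgueLocalSmall h56
    fun _k _γ hk hγ _T_L T_R hTL _hTR => homogeneouslyPinnedChain_localSmall hk hγ three_pos hTL T_R

end Literature.Barriers.AtomisticToContinuum

end
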